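import Summits.CriticalPhenomena.PercolationContinuityZ3.Theorems.PercNearOneGluingNoHeavyQuantDIBStarFloorSplitInduction
import Summits.CriticalPhenomena.PercolationContinuityZ3.Theorems.PercNearOneGluingNoHeavyQuantIndepBlobSmallCloud
import HarnessLib

/-!
# QUANT lane R8, Conjecture DIB\* — the floor-split step lemma NARROWED by census-1 g15's small-cloud theorem:
# the hard instance may be assumed to have light blobs of total size `≥ j + 1`

builds on p205010 (kernel theorem, internal audit signed; external expert review pending)

Statement + support file (`--supports stmt-CriticalPhenomena-4575`), QUANT lane lead (gen 17); memo
`run/shared/lean/prim/quant/prim-quant-lead-g17/LEAD-NOTES-G17.md` N33.  ONE `Prop` definition (the `@[conjecture]` `StepLemmaFSBig`), theorems otherwise; no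
sorries, standard axioms.

`…QuantDIBStarFloorSplitInduction` (lead g17, p259002) proved `StepLemmaFS ↔ ∀ x < 1, DIBStar x`: Conjecture DIB\* is one ∀∃ statement about a single HARD
instance (floor `1/2 < x < 1`, light sizes `≤ j`, heavy total `≤ 2j`, no heavy giant, two distinct non-empty light blobs, credit `> 2j`) given the capped row of each
one-blob-deleted sub-system.  Census-1 g15's `IndepBlob.dibStar_of_lightTotal_le` (p257153, `…QuantIndepBlobSmallCloud`: DIB\* for every instance whose LIGHT BLOBS
TOTAL AT MOST `j`, any number of lights, every floor `0 < x < 1`) removes one more family from the hard class: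

* `Quant.IndepBlob.StepLemmaFSBig` (`@[conjecture]`) — `StepLemmaFS` with the extra hypothesis `j + 1 ≤ Σ_{k : g k < x} a k` (the light cloud alone could reach
  the target).
* `Quant.IndepBlob.stepLemmaFS_of_big : StepLemmaFSBig → StepLemmaFS` (small clouds by p257153), hence
  **`dibStar_of_stepLemmaFSBig`** and **`stepLemmaFSBig_iff_dibStar : StepLemmaFSBig ↔ ∀ x < 1, DIBStar x`.**

So the OPEN CLASS of T-DIB is now exactly: `1/2 < x < 1`, all sizes `≤ j`, heavy total `≤ 2j`, at least two non-empty light blobs with light total `≥ j + 1`,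
credit `> 2j` — given DIB\* (capped, every floor) for every proper one-blob deletion.  [this work]; the gluing rows served [cite: KozmaNitzan2024, Conjecture 3 (p. 15)].
-/

namespace Summit.CriticalPhenomena.PercolationContinuityZ3.Theorems

namespace Quant

namespace IndepBlob

open Finset

/-- **CONJECTURE — the floor-split step lemma on BIG light clouds** (lead g17): `StepLemmaFS` (`…QuantDIBStarFloorSplitInduction`) restricted to hard
instances whose light blobs total at least `j + 1`.  Equivalent to `∀ x < 1, DIBStar x` (`stepLemmaFSBig_iff_dibStar`).  Evidence: that of `StepLemmaFS`
(kit j128350/j128351/j128353/j128354: 3 215 352 exact hard instances, 0 failures of the single floor split; adversarial j128590: 0 failures).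
builds on p205010 (kernel theorem, internal audit signed; external expert review pending). [this work] [status: open] -/
@[conjecture] def StepLemmaFSBig : Prop :=
  ∀ (κ : Type) [Fintype κ] [DecidableEq κ] (a : κ → ℕ) (g : κ → ℝ) (j : ℕ) (x : ℝ),
    1 / 2 < x → x < 1 →
    (∀ k, 0 ≤ g k ∧ g k ≤ 1) →
    (∀ k, g k < x → a k ≤ j) →
    (∑ k ∈ Finset.univ.filter (fun k => x ≤ g k), a k ≤ 2 * j) →
    (∀ k, x ≤ g k → a k ≤ j) →
    (∃ k₁ k₂, k₁ ≠ k₂ ∧ g k₁ < x ∧ 0 < a k₁ ∧ g k₂ < x ∧ 0 < a k₂) →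
    (j + 1 ≤ ∑ k ∈ Finset.univ.filter (fun k => g k < x), a k) →
    (2 * j : ℝ) < ∑ k, (a k : ℝ) * (if x ≤ g k then g k else (g k - x ^ 2) / (1 - x)) →
    (∀ k, 0 < a k → RootDec.CappedRows (Function.update a k 0) g) →
    x ≤ ∑ W : Finset κ, (∏ k, if k ∈ W then g k else 1 - g k) * (if j + 1 ≤ ∑ k ∈ W, a k then (1 : ℝ) else 0)

/-- **Small clouds are kernel**: `StepLemmaFSBig → StepLemmaFS` (census-1 g15's `dibStar_of_lightTotal_le` for light total `≤ j`). [this work] -/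
theorem stepLemmaFS_of_big (H : StepLemmaFSBig) : StepLemmaFS := by
  intro κ _ _ a g j x hx hx1 hg hlight hcorner hnogiant htwo hcredit hIH
  by_cases hsmall : ∑ k ∈ Finset.univ.filter (fun k => g k < x), a k ≤ j
  · exact dibStar_of_lightTotal_le x (by linarith) hx1 a g j hg hsmall hcredit
  · exact H κ a g j x hx hx1 hg hlight hcorner hnogiant htwo (by omega) hcredit hIH

/-- The narrowed step lemma follows from DIB\* below one. [this work] -/
theorem stepLemmaFSBig_of_dibStar (h : ∀ x : ℝ, x < 1 → DIBStar x) : StepLemmaFSBig :=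
  fun κ _ _ a g j x _ hx1 hg hlight _ _ _ _ hcredit _ => h x hx1 κ a g j hg hlight hcredit

/-- **`StepLemmaFSBig ⟹ DIB\*` at every floor `x < 1`.** [this work] -/
theorem dibStar_of_stepLemmaFSBig (H : StepLemmaFSBig) (x : ℝ) (hx1 : x < 1) : DIBStar x :=
  dibStar_of_stepLemmaFS (stepLemmaFS_of_big H) x hx1

/-- **T-DIB ≡ the narrowed step lemma**: `StepLemmaFSBig ↔ ∀ x < 1, DIBStar x`. [this work] -/
theorem stepLemmaFSBig_iff_dibStar : StepLemmaFSBig ↔ ∀ x : ℝ, x < 1 → DIBStar x :=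
  ⟨fun H x hx => dibStar_of_stepLemmaFSBig H x hx, stepLemmaFSBig_of_dibStar⟩

end IndepBlob

end Quant

end Summit.CriticalPhenomena.PercolationContinuityZ3.Theorems
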